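import Summits.QuantumFields.YangMills.Theorems.ParabolicTrajectoryLatticeGapOnTrajectorySparseDefectDefs
import Summits.QuantumFields.YangMills.Theorems.ParabolicTrajectoryLatticeGapOnTrajectoryStubTorusRange
import Summits.QuantumFields.YangMills.Theorems.ParabolicTrajectoryLatticeGapOnTrajectoryStubTorusCrude
import HarnessLib

/-!
# Crux `LatticeGapOnTrajectory` (stmt-QuantumFields-10523), line `sparse-defect-orbit-window`:
# the PHYSICS CORE of the typical window package (lead c8 reshape, 2026-08-17)

Route-posited objects (D-0016 `<Route><Crux>…Defs` file, `--supports stmt-QuantumFields-10523`) for the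
registered skeleton `Cruxes/LatticeGapOnTrajectory/Lines/sparse_defect_orbit_window.lean`. Nothing about
mass gaps is asserted: `TypicalCoreAlongP` is the statement the registered physics stub
`stub_typicalCore` proves (open; Sub₁ strength), and the theorems are G-blind plumbing, all proved.

The typical orbit–Kantorovich package `TypicalOrbitWindowsAlongP r M sch n` (SparseDefectDefs, p127447)
asks, torus by torus and frame family by frame family, for
`IsTypicalKRWindow (cellOf q) (orbitWeight r α q) (torusYM …) 1 n₀ γ₀ kp good A` plus hereditary / state
sparseness and the rough-centre bound. SEVEN of the eleven fields of `IsTypicalKRWindow` are G-blind facts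
about Wilson's torus specification read in the capped orbit weight on axis frames, valid for EVERY
coupling, resolution `α > 0`, torus and frame family, and are now tree theorems:
`w_nonneg`, `w_le` (cap `R = 1`), `w_local` (`orbitWeight_local` below), `A_nonneg`, `range`
(`stub_torusRange`, p140790: finite range ONE cell), `crude` (`stub_torusCrude`, p140789: the
total-variation clause with the explicit constant `crudeConst β α b = 2(1 + 2e²|β|α·7680 b⁴)` at frame
scale `b`). What is left — `k_nonneg`, `good_meas`, `good_local`, `contract`, `sum_le`, `HereditarySparse`,
`SparseUnder`, `RoughCentreBound` and the parameter clause `ε_k (1 + A_k) → 0` AT THE G-BLIND CRUDE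
CONSTANT `A_k = crudeConst β_k α_k (t·M^{n_k})` — is the physics core `TypicalCoreAlongP` (§2), and
`typicalOrbitWindowsAlongP_of_core` (§2, kernel-checked) is the composition core + plumbing ⇒ package.
Two further G-blind tools for count-type good events are landed separately
(`stub_sparseUnderOfLargeField` p140953, `stub_largeFieldCountEvent` p140797).

References: Dobrushin–Shlosman 1985 (constructive criterion, the one-cell total-variation input);
Föllmer 1988 Ch. I §2; the line card `Cruxes/LatticeGapOnTrajectory/Lines/sparse-defect-orbit-window.md`.
-/

set_option autoImplicit false

noncomputable section

namespace Summit.QuantumFields.YangMills.Cruxes.LatticeGapOnTrajectory.SparseDefectOrbitWindow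

open scoped BigOperators Topology ENNReal ProbabilityTheory
open Filter MeasureTheory
open Literature.Probability.LatticeModels (Specification IsSpecification IsGibbsMeasure glueWith)
open Literature.MathematicalPhysics.QuantumFieldTheory
open Summit.QuantumFields.YangMills.Theses.ParabolicTrajectory
open Summit.QuantumFields.YangMills.Cruxes.LatticeGapOnTrajectory.OrbitKantorovichFiniteSize

/-! ## §1 The G-blind crude constant and the locality of the orbit weight -/

/-- **The G-blind crude constant** of Wilson's torus specification in the orbit weight at resolution
`α` on axis frames of scale `b` (TorusKernels p121572, `abs_windowAvg_sub_le_orbitWeight_frame`):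
`A(β, α, b) = 2 (1 + 2e²|β|α · 7680 b⁴)`. -/
def crudeConst (β α : ℝ) (b : ℕ) : ℝ :=
  2 * (1 + 2 * Real.exp 2 * |β| * α * (7680 * (b : ℝ) ^ 4))

/-- The crude constant is nonnegative for `α ≥ 0`. -/
theorem crudeConst_nonneg (β α : ℝ) (hα : 0 ≤ α) (b : ℕ) : 0 ≤ crudeConst β α b := by
  unfold crudeConst; positivity

/-- **Locality of the capped orbit weight** (G-blind; stub (W) of the lead c8 reshape): the capped
orbit weight of a cell reads the two configurations on that cell only (`cellDev` compares `U e` with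
`(U'^g) e` over the links `e` of the cell, and `gaugeTransform g U' e` reads `U' e` alone). Field
`w_local` of `IsTypicalKRWindow` / `IsKRWindow`. -/
theorem orbitWeight_local :
    ∀ (G : Type) [Group G] [TopologicalSpace G] [IsTopologicalGroup G] [CompactSpace G]
      [MeasurableSpace G] [BorelSpace G] (r : LatticeRep G) {N : ℕ} {μ : Fin 4 → ℕ}
      (q : (i : Fin 4) → ZMod N → ZMod (μ i + 1)) (α : ℝ) (c : CoarseIdx μ)
      (U U' V V' : GaugeConfig 4 N G),
      (∀ e, cellOf q e = c → U e = U' e) → (∀ e, cellOf q e = c → V e = V' e) →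
        orbitWeight r α q c U V = orbitWeight r α q c U' V' := by
  intro G _ _ _ _ _ _ r N μ q α c U U' V V' hU hV
  unfold orbitWeight cellDev
  congr 3
  funext g
  congr 1
  funext e
  rw [hU e.1 e.2]
  simp only [gaugeTransform, hV e.1 e.2]

/-! ## §2 The physics core and the composition core + plumbing ⇒ typical package -/

section Core

variable {G : Type} [Group G] [TopologicalSpace G] [IsTopologicalGroup G] [CompactSpace G]
  [MeasurableSpace G] [BorelSpace G]

/-- **The PHYSICS CORE of the typical package (`TypicalCoreAlongP`)** — what remains of
`TypicalOrbitWindowsAlongP` once the G-blind fields are supplied by (W)(R)(C): a cell scale `t ≥ 1`,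
radius `n₀`, ratio `γ₀ < 1`, resolutions `α_k > 0` with the polynomial clause, sparseness levels
`ε_k ≥ 0` with `ε_k (1 + A_k) → 0` AT THE G-BLIND CRUDE CONSTANT `A_k = crudeConst β_k α_k (t·M^{n_k})`,
rough-centre constants `K_s`, and — eventually in `k`, on every torus `S ≥ L_k`, for every frame family
of scale `t·M^{n_k}` — SOME nonnegative profile `kp` and SOME measurable cell-local good events with:
the Dobrushin–Shlosman contraction for boundary data good on the shell (`contract`), the received-sum
condition (`sum_le`), hereditary joint sparseness under the window kernels, joint sparseness under
Wilson's measure, and the rough-centre bound. This is the open content (Sub₁ strength). -/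
def TypicalCoreAlongP (r : LatticeRep G) (M : ℕ) (sch : SpeciesScheme (YMSpecies G)) (n : ℕ → ℕ) :
    Prop :=
  ∃ (t n₀ : ℕ) (γ₀ : ℝ) (α ε : ℕ → ℝ) (K : ℕ → ℝ), 1 ≤ t ∧ 0 ≤ γ₀ ∧ γ₀ < 1 ∧ (∀ k, 0 < α k) ∧
    (∀ k, 0 ≤ ε k) ∧
    Tendsto (fun k => ε k * (1 + crudeConst (sch.β k) (α k) (t * M ^ n k))) atTop (𝓝 0) ∧
    (∃ (p₀ : ℕ) (K₀ : ℝ), ∀ᶠ k in atTop, |sch.β k| * α k ≤ K₀ * ((sch.a k)⁻¹) ^ p₀) ∧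
    ∀ s : ℕ, ∀ᶠ k in atTop, ∀ S : ℕ, sch.L k ≤ S →
      ∀ (μ : Fin 4 → ℕ) (q : (i : Fin 4) → ZMod (2 * S + 1) → ZMod (μ i + 1)),
        (∀ i, 2 * n₀ + 3 ≤ μ i + 1) → (∀ i, IsTorusFrame (2 * S + 1) (t * M ^ n k) (q i)) →
          (∃ (kp : CoarseIdx μ → CoarseIdx μ → CoarseIdx μ → ℝ)
              (good : CoarseIdx μ → Set (GaugeConfig 4 (2 * S + 1) G)),
              (∀ c y x, 0 ≤ kp c y x) ∧
              (∀ y, MeasurableSet (good y)) ∧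
              (∀ (y : CoarseIdx μ) (U V : GaugeConfig 4 (2 * S + 1) G),
                  (∀ e, cellOf q e = y → U e = V e) → (U ∈ good y ↔ V ∈ good y)) ∧
              (∀ (c y : CoarseIdx μ), n₀ < cdist c y → ∀ (ω η : GaugeConfig 4 (2 * S + 1) G),
                  (∀ e, cellOf q e ≠ y → ω e = η e) →
                  (∀ y', cdist c y' = n₀ + 1 → ω ∈ good y' ∧ η ∈ good y') →
                  ∀ (f : GaugeConfig 4 (2 * S + 1) G → ℝ) (δ : CoarseIdx μ → ℝ), Measurable f →
                    (∃ B, ∀ U, |f U| ≤ B) → DependsOn f {e | cdist c (cellOf q e) ≤ n₀} →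
                    IsCellLipBound (cellOf q) (orbitWeight r (α k) q) f δ →
                      |windowAvg (torusYM r.ρ (sch.β k) (2 * S + 1)) (windowVol (cellOf q) n₀ c) f ω -
                          windowAvg (torusYM r.ρ (sch.β k) (2 * S + 1))
                            (windowVol (cellOf q) n₀ c) f η| ≤
                        (∑ x ∈ Finset.univ.filter (fun x => cdist c x ≤ n₀), kp c y x * δ x) *
                          orbitWeight r (α k) q y ω η) ∧
              (∀ x : CoarseIdx μ,
                  ∑ c ∈ Finset.univ.filter (fun c => cdist c x ≤ n₀),
                      ∑ y ∈ Finset.univ.filter (fun y => cdist c y = n₀ + 1), kp c y x ≤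
                    γ₀ * (Finset.univ.filter (fun c => cdist c x ≤ n₀)).card) ∧
              HereditarySparse (cellOf q) (torusYM r.ρ (sch.β k) (2 * S + 1)) n₀ good (ε k) ∧
              SparseUnder (wilsonMeasure (d := 4) (L := 2 * S + 1) r.ρ (sch.β k)) good (ε k)) ∧
          RoughCentreBound r (sch.β k) (2 * S + 1) q (α k) n₀ s (K s)

/-- **Composition (kernel-checked): physics core + plumbing (W)(R)(C) ⇒ the typical package**, with the
crude constants `A_k := crudeConst β_k α_k (t·M^{n_k})`. -/
theorem typicalOrbitWindowsAlongP_of_core (r : LatticeRep G) {M : ℕ} {sch : SpeciesScheme (YMSpecies G)}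
    {n : ℕ → ℕ} (h : TypicalCoreAlongP r M sch n) : TypicalOrbitWindowsAlongP r M sch n := by
  obtain ⟨t, n₀, γ₀, α, ε, K, ht, hγ₀, hγ₁, hα, hε, hlim, hP, hrest⟩ := h
  refine ⟨t, n₀, γ₀, α, fun k => crudeConst (sch.β k) (α k) (t * M ^ n k), ε, K, ht, hγ₀, hγ₁, hα,
    hε, hlim, hP, fun s => ?_⟩
  filter_upwards [hrest s] with k hk S hS μ q hμ hframe
  obtain ⟨⟨kp, good, hk0, hgm, hgl, hcontract, hsum, hHS, hSU⟩, hRC⟩ := hk S hS μ q hμ hframe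
  refine ⟨⟨kp, good, ?_, hHS, hSU⟩, hRC⟩
  exact
    { w_nonneg := fun c σ τ =>
        le_min zero_le_one (div_nonneg (SlabClustering.cellDev_nonneg r q c σ τ) (hα k).le)
      w_le := fun c σ τ => min_le_left _ _
      w_local := fun c σ σ' τ τ' hσ hτ => orbitWeight_local G r q (α k) c σ σ' τ τ' hσ hτ
      k_nonneg := hk0
      A_nonneg := crudeConst_nonneg _ _ (hα k).le _
      good_meas := hgm
      good_local := hgl
      range := fun c y hcy ω η hωη f hf hfb hdep =>
        stub_torusRange G r (sch.β k) q hframe n₀ c y hcy ω η hωη f hf hfb hdep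
      contract := hcontract
      crude := fun c y hcy ω η hωη f δ hf hfb hdep hLip =>
        stub_torusCrude G r (sch.β k) (α k) (hα k) q hframe n₀ c y hcy ω η hωη f δ hf hfb hdep hLip
      sum_le := hsum }

end Core

end Summit.QuantumFields.YangMills.Cruxes.LatticeGapOnTrajectory.SparseDefectOrbitWindow

end
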